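import Mathlib
import HarnessLib

/-!
# Diagonal selection of scales

Topic `Literature/Probability/Percolation`; family `crit-perc`. The bookkeeping step turning
constructions "at precision `ε`, valid for `δ < δ₀(ε)`" into a single family indexed by the
mesh `δ` with precision `ε(δ) → 0` — as in Bollobás–Riordan's Lemma 14 (*Percolation* (2006),
Ch. 7 p. 184: "As `δ → 0`, the domains `G_δ^±` are `o(1)`-close to `D₄`", obtained from
Claim 20, p. 192: "If `ε₁ > 0` is chosen small enough, and `G_δ^-, G_δ^+` are constructed as
above, then …").

* `exists_scale_tendsto` — if `P ε δ` holds for every `ε > 0` and all small `δ > 0`, there is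
  `e : ℝ → ℝ`, positive, tending to `0` along `𝓝[>] 0`, with `P (e δ) δ` eventually.

## References

* B. Bollobás, O. Riordan, *Percolation*, Cambridge University Press (2006), Ch. 7, Lemma 14
  p. 184, Claim 20 p. 192.
-/

noncomputable section

open Filter Topology Set

namespace Literature.Probability.Percolation

/-- **Diagonal selection of scales.** If for every `ε > 0` a property `P ε δ` holds for all
sufficiently small `δ > 0`, then there is a choice of precisions `ε(δ) > 0`, `ε(δ) → 0` as
`δ → 0⁺`, with `P (ε δ) δ` for all small `δ > 0` (the precisions `1/(n+1)` at nested
thresholds). [folklore] -/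
theorem exists_scale_tendsto {P : ℝ → ℝ → Prop} (hP : ∀ ε > 0, ∃ δ₀ > 0, ∀ δ, 0 < δ → δ < δ₀ → P ε δ) :
    ∃ e : ℝ → ℝ, Tendsto e (𝓝[>] 0) (𝓝 0) ∧ (∀ δ, 0 < e δ) ∧ ∀ᶠ δ in 𝓝[>] (0 : ℝ), P (e δ) δ := by
  classical
  -- thresholds `d n` for the precisions `1/(n+1)`, made decreasing and `≤ 1/(n+1)`
  choose d0 hd0 hPd0 using fun n : ℕ => hP (1 / ((n : ℝ) + 1)) (by positivity)
  let d : ℕ → ℝ := fun n => Nat.rec (min (d0 0) 1) (fun n dn => min (min (d0 (n + 1)) (dn / 2)) (1 / ((n : ℝ) + 2))) n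
  have hd_zero : d 0 = min (d0 0) 1 := rfl
  have hd_succ : ∀ n, d (n + 1) = min (min (d0 (n + 1)) (d n / 2)) (1 / ((n : ℝ) + 2)) := fun n => rfl
  have hdpos : ∀ n, 0 < d n := by
    intro n
    induction n with
    | zero => rw [hd_zero]; exact lt_min (hd0 0) one_pos
    | succ n ih => rw [hd_succ]; exact lt_min (lt_min (hd0 _) (by linarith)) (by positivity)
  have hdle : ∀ n, d n ≤ d0 n := by
    intro n
    cases n with
    | zero => rw [hd_zero]; exact min_le_left _ _
    | succ n => rw [hd_succ]; exact (min_le_left _ _).trans (min_le_left _ _)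
  have hdanti : ∀ n, d (n + 1) ≤ d n / 2 := fun n => by rw [hd_succ]; exact (min_le_left _ _).trans (min_le_right _ _)
  have hdsmall : ∀ n, d n ≤ 1 / ((n : ℝ) + 1) := by
    intro n
    cases n with
    | zero => rw [hd_zero]; simp
    | succ n => rw [hd_succ]; push_cast; rw [show (n : ℝ) + 1 + 1 = n + 2 by ring]; exact min_le_right _ _
  have hdmono : ∀ m n, m ≤ n → d n ≤ d m := by
    intro m n hmn
    induction hmn with
    | refl => exact le_rfl
    | @step k _ ih => exact ((hdanti k).trans (by linarith [hdpos k])).trans ih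
  -- the level of `δ`: the largest `n` with `δ < d n` (for `δ < d 0`)
  -- define `e δ = 1/(N δ + 1)` where `N δ = sup {n | δ < d n}` when `δ < d 0`, else `1`
  have hfin : ∀ δ, 0 < δ → {n : ℕ | δ < d n}.Finite := by
    intro δ hδ
    obtain ⟨N, hN⟩ := exists_nat_gt (1 / δ)
    refine (Set.finite_lt_nat N).subset fun n hn => ?_
    simp only [Set.mem_setOf_eq] at hn ⊢
    by_contra hle; push Not at hle
    have h1 : d n ≤ 1 / ((n : ℝ) + 1) := hdsmall n
    have h2 : 1 / ((n : ℝ) + 1) ≤ 1 / ((N : ℝ)) := by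
      apply one_div_le_one_div_of_le (by exact_mod_cast (Nat.pos_of_ne_zero (by rintro rfl; simp at hN; linarith [hδ]) ))
      exact_mod_cast Nat.le_succ_of_le hle
    have h3 : 1 / (N : ℝ) < δ := by
      rw [div_lt_iff₀ (by
        have : (0:ℝ) < 1 / δ := by positivity
        linarith)] ; rw [div_lt_iff₀ hδ] at hN; linarith
    linarith
  let N : ℝ → ℕ := fun δ => @dite ℕ (0 < δ ∧ δ < d 0) (Classical.propDecidable _) (fun h => (hfin δ h.1).toFinset.sup id) (fun _ => 0)
  have hNdef : ∀ δ, N δ = @dite ℕ (0 < δ ∧ δ < d 0) (Classical.propDecidable _) (fun h => (hfin δ h.1).toFinset.sup id) (fun _ => 0) := fun δ => rfl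
  let e : ℝ → ℝ := fun δ => 1 / ((N δ : ℝ) + 1)
  have hNspec : ∀ δ, 0 < δ → δ < d 0 → δ < d (N δ) ∧ ∀ n, δ < d n → n ≤ N δ := by
    intro δ hδ hδ0
    have hN : N δ = (hfin δ hδ).toFinset.sup id := by rw [hNdef]; exact dif_pos ⟨hδ, hδ0⟩
    constructor
    · -- the sup is attained (nonempty: contains 0)
      have hne : (hfin δ hδ).toFinset.Nonempty := ⟨0, by simp [hδ0]⟩
      obtain ⟨n, hn, hmax⟩ := Finset.exists_max_image _ id hne
      have : (hfin δ hδ).toFinset.sup id = n := by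
        apply le_antisymm (Finset.sup_le fun m hm => hmax m hm)
        exact Finset.le_sup (f := id) hn
      rw [hN, this]
      simpa using hn
    · intro n hn
      rw [hN]
      exact Finset.le_sup (f := id) (by simpa using hn)
  refine ⟨e, ?_, fun δ => by positivity, ?_⟩
  · -- `e δ → 0`: for `δ < d n` we have `N δ ≥ n`, so `e δ ≤ 1/(n+1)`
    rw [Metric.tendsto_nhdsWithin_nhds]
    intro ε hε
    obtain ⟨n, hn⟩ := exists_nat_gt (1 / ε)
    refine ⟨d n, hdpos n, fun δ hδ hdist => ?_⟩
    rw [Set.mem_Ioi] at hδ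
    rw [dist_zero_right, Real.norm_eq_abs, abs_of_pos hδ] at hdist
    have hδ0 : δ < d 0 := hdist.trans_le (hdmono 0 n (Nat.zero_le _))
    have hNn : n ≤ N δ := (hNspec δ hδ hδ0).2 n hdist
    rw [dist_zero_right, Real.norm_eq_abs, abs_of_pos (by positivity)]
    show 1 / ((N δ : ℝ) + 1) < ε
    have h1 : 1 / ((N δ : ℝ) + 1) ≤ 1 / ((n : ℝ) + 1) :=
      one_div_le_one_div_of_le (by positivity) (by exact_mod_cast Nat.succ_le_succ hNn)
    have h2 : 1 / ((n : ℝ) + 1) < ε := by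
      rw [div_lt_iff₀ (by positivity)]; rw [div_lt_iff₀ hε] at hn; nlinarith
    linarith
  · -- eventually `P (e δ) δ`: for `0 < δ < d 0`, `δ < d (N δ) ≤ d0 (N δ)`
    have hev : ∀ᶠ δ in 𝓝[>] (0 : ℝ), δ < d 0 := by
      rw [Filter.Eventually, Metric.mem_nhdsWithin_iff]
      exact ⟨d 0, hdpos 0, fun δ ⟨h1, _⟩ => by
        rw [Metric.mem_ball, dist_zero_right, Real.norm_eq_abs] at h1; exact (le_abs_self δ).trans_lt h1⟩
    have hpos : ∀ᶠ δ in 𝓝[>] (0 : ℝ), 0 < δ := eventually_nhdsWithin_of_forall fun δ hδ => hδ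
    filter_upwards [hev, hpos] with δ hδ0 hδ
    have h := (hNspec δ hδ hδ0).1
    exact hPd0 (N δ) δ hδ (h.trans_le (hdle _))

end Literature.Probability.Percolation
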